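import Literature.Analysis.FluidPDE.PeriodicGalileanFrameBlowup
import Literature.Analysis.FluidPDE.ClassicalSolutionGalileanLocal
import HarnessLib

/-!
# In the printed periodic class, every solvable datum also has a non-continuable smooth solution
# (Tao 2013, §3 eq. (galilean), §1 after Prop. 1.7)

Literature file (topic `Analysis/FluidPDE`; all statements are theorems), third of the
`PeriodicGalilean*` group. `PeriodicGalileanFrameBlowup` exhibits, at the datum `u₀ = 0`, a smooth
`u`-periodic solution on `[0, a)` that cannot be continued to `[0,∞)` although its data have a
global smooth solution. Here the same is proved for EVERY datum that has a global smooth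
`u`-periodic solution of the unforced system (Fefferman's printed class: (10) constrains `u`
only): boosting that solution into the frame `ξ(t) = φ_a(t) w`,
`φ_a(t) = 1/(a−t) − 1/a − t/a²` (`φ_a(0) = φ_a′(0) = 0`, `φ_a′(t) = (a−t)⁻² − a⁻² → ∞` as
`t → a⁻`), smooth on `(−∞, a)` only, gives a classical solution on `ℝ^ι × [0, a)` with the same
datum, periodic velocity, and `‖U(t, y)‖ → ∞` at every `y` (tree
`IsClassicalNSSolutionOn.galileanBoostOn_Ico`; the velocity of a global solution is bounded on
`[0, a] × ℝ^ι` by periodicity and continuity, `exists_forall_norm_le_of_periodic_continuousOn`).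

So, in the printed periodic class: **(B)-solvability of `(ν, u₀)` implies the Theorem-2.3-type
statement «there is a smooth periodic solution from `u₀` that cannot be smoothly continued to
`[0,∞)`» for the same `(ν, u₀)`** (`exists_nonContinuable_of_globalPeriodicSolution`), for every
`a > 0`. Such ∃-statements are therefore never evidence for (D), whose conclusion negates
(B)-solvability (barrier entry `Literature.Barriers.NavierStokesRegularity.UnnormalisedPressureLoophole`).
Source of the symmetry: T. Tao, Anal. PDE 6 (2013), §3 eq. (galilean) ("valid for any smooth
function `v`"; "preserves periodicity … the pressure was not required to be periodic") and §1
after Prop. 1.7 ("the technical loophole of non-periodic pressure") [Tao2013Localisation];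
C. Fefferman's Clay text, (B)/(D), (10)–(11) [FeffermanClay2006].
-/

noncomputable section

open Set Function Filter InnerProductSpace
open scoped ContDiff RealInnerProductSpace Topology

namespace Literature.Analysis.FluidPDE

/-! ### A continuous, spatially periodic field is bounded on compact time sets -/

section Bounded

variable {ι : Type*} [Fintype ι] [DecidableEq ι] {F : Type*} [NormedAddCommGroup F]

omit [DecidableEq ι] in
/-- A point of the unit cube `[0,1)^ι` has norm at most `card ι + 1`. [folklore] -/
private theorem norm_le_of_mem_unitCube {y : EuclideanSpace ℝ ι}
    (hy : y ∈ Literature.Analysis.FunctionSpaces.Torus.unitCube ι) :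
    ‖y‖ ≤ (Fintype.card ι : ℝ) + 1 := by
  have hsq : ‖y‖ ^ 2 ≤ (Fintype.card ι : ℝ) := by
    rw [EuclideanSpace.real_norm_sq_eq]
    calc ∑ i, y i ^ 2 ≤ ∑ _i : ι, (1 : ℝ) := Finset.sum_le_sum fun i _ => by
            have h := hy i
            nlinarith [h.1, h.2]
      _ = (Fintype.card ι : ℝ) := by simp
  nlinarith [norm_nonneg y, sq_nonneg (‖y‖ - 1)]

/-- **A field `w : ℝ → ℝ^ι → F` that is jointly continuous on `K × ℝ^ι`, `K` compact, and
`ℤ^ι`-periodic in space at each time `t ∈ K` is bounded on `K × ℝ^ι`** (reduce `x` to the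
fundamental domain, tree `Torus.repr ∘ Torus.proj`, and use compactness of `K × B̄(0, card ι + 1)`;
Grafakos §3.1.1: periodic functions are functions on the compact torus). [cite: Grafakos2014, §3.1.1] -/
theorem exists_forall_norm_le_of_periodic_continuousOn {w : ℝ → EuclideanSpace ℝ ι → F}
    {K : Set ℝ} (hK : IsCompact K) (hc : ContinuousOn (uncurry w) (K ×ˢ univ))
    (hper : ∀ t ∈ K, IsLatticePeriodic (w t)) : ∃ C : ℝ, ∀ t ∈ K, ∀ x, ‖w t x‖ ≤ C := by
  set R : ℝ := (Fintype.card ι : ℝ) + 1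
  have hKB : IsCompact (K ×ˢ Metric.closedBall (0 : EuclideanSpace ℝ ι) R) :=
    hK.prod (isCompact_closedBall 0 R)
  obtain ⟨C, hC⟩ := hKB.exists_bound_of_continuousOn
    (hc.mono (prod_mono Subset.rfl (subset_univ _)))
  refine ⟨C, fun t ht x => ?_⟩
  obtain ⟨k, hk⟩ :=
    Literature.Analysis.FunctionSpaces.Torus.exists_repr_proj_eq_add_latticeVec_holds (d := ι) x
  set x' := Literature.Analysis.FunctionSpaces.Torus.repr
    (Literature.Analysis.FunctionSpaces.Torus.proj x) with hx'
  have hwx : w t x' = w t x := by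
    rw [hk]
    exact Literature.Analysis.FunctionSpaces.Torus.IsLatticePeriodic.add_latticeVec_holds
      (hper t ht) x k
  have hx'B : x' ∈ Metric.closedBall (0 : EuclideanSpace ℝ ι) R := by
    rw [Metric.mem_closedBall, dist_zero_right]
    exact norm_le_of_mem_unitCube (Literature.Analysis.FunctionSpaces.Torus.repr_mem_unitCube _)
  have := hC (t, x') ⟨ht, hx'B⟩
  simpa [hwx] using this

end Bounded

/-! ### The frame `φ_a(t) = 1/(a−t) − 1/a − t/a²` -/

section Frame

/-- `φ_a′(t) = (a−t)⁻² − a⁻²` away from `t = a`. [folklore] -/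
private theorem hasDerivAt_frame (a : ℝ) {t : ℝ} (ht : t ≠ a) :
    HasDerivAt (fun s : ℝ => 1 / (a - s) - 1 / a - s / a ^ 2) (1 / (a - t) ^ 2 - 1 / a ^ 2) t := by
  have h1 : HasDerivAt (fun s : ℝ => a - s) (-1) t := (hasDerivAt_id' t).const_sub a
  have h2 : HasDerivAt (fun s : ℝ => (a - s)⁻¹) (-(-1) / (a - t) ^ 2) t :=
    h1.inv (sub_ne_zero.2 (Ne.symm ht))
  have h3 : HasDerivAt (fun s : ℝ => s / a ^ 2) (1 / a ^ 2) t := by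
    simpa using (hasDerivAt_id' t).div_const (a ^ 2)
  have h4 := (h2.sub_const a⁻¹).sub h3
  simp only [one_div]
  refine h4.congr_deriv ?_
  simp only [one_div]
  ring

/-- `φ_a` is smooth on `(−∞, a)`. [folklore] -/
private theorem contDiffOn_frame (a : ℝ) :
    ContDiffOn ℝ ∞ (fun s : ℝ => 1 / (a - s) - 1 / a - s / a ^ 2) (Iio a) := by
  refine (ContDiffOn.sub ?_ contDiffOn_const).sub (contDiffOn_id.div_const _)
  simp only [one_div]
  exact (contDiffOn_const.sub contDiffOn_id).inv fun s hs => sub_ne_zero.2 (ne_of_gt hs)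

/-- `φ_a(0) = 0`. [folklore] -/
private theorem frame_zero (a : ℝ) : (fun s : ℝ => 1 / (a - s) - 1 / a - s / a ^ 2) 0 = 0 := by
  simp

/-- `φ_a′(0) = 0` (`a ≠ 0`). [folklore] -/
private theorem deriv_frame_zero {a : ℝ} (ha : a ≠ 0) :
    deriv (fun s : ℝ => 1 / (a - s) - 1 / a - s / a ^ 2) 0 = 0 := by
  rw [(hasDerivAt_frame a (Ne.symm ha)).deriv]
  simp

/-- `φ_a′(t) → +∞` as `t → a⁻`. [folklore] -/
private theorem tendsto_deriv_frame {a : ℝ} :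
    Tendsto (fun t => deriv (fun s : ℝ => 1 / (a - s) - 1 / a - s / a ^ 2) t) (𝓝[<] a) atTop := by
  have h1 : Tendsto (fun t : ℝ => a - t) (𝓝[<] a) (𝓝[>] 0) := by
    refine tendsto_nhdsWithin_of_tendsto_nhds_of_eventually_within _ ?_ ?_
    · have : Tendsto (fun t : ℝ => a - t) (𝓝 a) (𝓝 (a - a)) :=
        (continuous_const.sub continuous_id).tendsto a
      rw [sub_self] at this
      exact this.mono_left nhdsWithin_le_nhds
    · filter_upwards [self_mem_nhdsWithin] with t ht
      have ht' : t < a := ht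
      exact sub_pos.2 ht'
  have h2 : Tendsto (fun t : ℝ => 1 / (a - t)) (𝓝[<] a) atTop := by
    simpa [one_div, Function.comp_def] using tendsto_inv_nhdsGT_zero.comp h1
  have h3 : Tendsto (fun t : ℝ => (1 / (a - t)) ^ 2 - 1 / a ^ 2) (𝓝[<] a) atTop :=
    tendsto_atTop_add_const_right _ _ ((tendsto_pow_atTop two_ne_zero).comp h2)
  refine h3.congr' ?_
  filter_upwards [self_mem_nhdsWithin] with t ht
  have ht' : t < a := ht
  rw [(hasDerivAt_frame a (ne_of_lt ht')).deriv, div_pow, one_pow]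

end Frame

/-! ### Non-continuable solutions from global ones -/

section Main

variable {ι : Type*} [Fintype ι] [DecidableEq ι]
variable {ν : ℝ} {u : ℝ → EuclideanSpace ℝ ι → EuclideanSpace ℝ ι}
  {u₀ : EuclideanSpace ℝ ι → EuclideanSpace ℝ ι} {p : ℝ → EuclideanSpace ℝ ι → ℝ}

/-- **In the printed periodic class, every solvable datum has a non-continuable smooth solution
too.** Let `(u, p)` be a solution of the unforced system with datum `u₀`, smooth on
`ℝ^ι × [0,∞)`, with `u(·, t)` periodic for `t ≥ 0` (Fefferman's (1)–(3), (10), (11), `f ≡ 0`).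
Then for every `a > 0` and `w ≠ 0` the accelerated-frame image
`U(t, y) = u(t, y + φ_a(t) w) − φ_a′(t) w`, `P(t, y) = p(t, y + φ_a(t) w) + φ_a″(t)⟪w, y⟫`,
`φ_a(t) = 1/(a−t) − 1/a − t/a²`, is a classical solution of the unforced system on
`ℝ^ι × [0, a)` with the SAME datum `u₀` and periodic velocity, and `‖U(t, y)‖ → ∞` as `t → a⁻`
for every `y`; in particular it has no continuation `(u', p')` smooth on `ℝ^ι × [0,∞)` solving
(1)–(3) with datum `u₀`. (Tao 2013: the Galilean symmetry is "valid for any smooth function `v`"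
and "preserves periodicity" in the printed sense.) [cite: Tao2013Localisation, §3 eq. (galilean)] -/
theorem exists_nonContinuable_of_globalPeriodicSolution (hns : IsNavierStokesSolution ν 0 u₀ u p)
    (hu : IsSmoothOnHalfSpace u) (hp : IsSmoothOnHalfSpace p)
    (hper : ∀ t, 0 ≤ t → IsLatticePeriodic (u t)) {a : ℝ} (ha : 0 < a)
    {w : EuclideanSpace ℝ ι} (hw : w ≠ 0) :
    ∃ (U : ℝ → EuclideanSpace ℝ ι → EuclideanSpace ℝ ι) (P : ℝ → EuclideanSpace ℝ ι → ℝ),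
      IsClassicalNSSolutionOn (Ico 0 a) ν 0 U P ∧ U 0 = u₀ ∧
        (∀ t ∈ Ico 0 a, IsLatticePeriodic (U t)) ∧
        (∀ y, Tendsto (fun t => ‖U t y‖) (𝓝[<] a) atTop) ∧
        ¬ ∃ (u' : ℝ → EuclideanSpace ℝ ι → EuclideanSpace ℝ ι) (p' : ℝ → EuclideanSpace ℝ ι → ℝ),
            IsSmoothOnHalfSpace u' ∧ IsSmoothOnHalfSpace p' ∧ IsNavierStokesSolution ν 0 u₀ u' p' ∧
              ∀ t ∈ Ico 0 a, u' t = U t ∧ p' t = P t := by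
  -- the global solution as a classical solution on `[0, a)`
  obtain ⟨hcl, h0⟩ := isNavierStokesSolution_and_smooth_iff.1 ⟨hns, hu, hp⟩
  have hclI : IsClassicalNSSolutionOn (Ico 0 a) ν 0 u p :=
    hcl.mono Ico_subset_Ici_self (uniqueDiffOn_Ico 0 a)
  -- the frame path `ξ(t) = φ_a(t) w`, smooth on `(−∞, a)`
  set φ : ℝ → ℝ := fun s => 1 / (a - s) - 1 / a - s / a ^ 2 with hφ
  have hξ : ContDiffOn ℝ ∞ (fun s => φ s • w) (Iio a) := (contDiffOn_frame a).smul contDiffOn_const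
  have hb := hclI.galileanBoostOn_Ico hξ (g := fun _ => (0 : ℝ)) contDiffOn_const
  -- derivatives of the frame path below `a`
  have hφd : ∀ t, t < a → DifferentiableAt ℝ φ t := fun t ht =>
    (hasDerivAt_frame a (ne_of_lt ht)).differentiableAt
  have hdξ : ∀ t, t < a → deriv (fun s => φ s • w) t = deriv φ t • w := fun t ht =>
    deriv_smul_const (hφd t ht) w
  -- a uniform bound for `u` on `[0, a] × ℝ^ι`
  obtain ⟨C, hC⟩ := exists_forall_norm_le_of_periodic_continuousOn (w := u) isCompact_Icc
    (hcl.smooth_velocity.continuousOn.mono (prod_mono Icc_subset_Ici_self Subset.rfl))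
    fun t ht => hper t ht.1
  -- blow-up of the boosted velocity
  have hblow : ∀ y, Tendsto (fun t => ‖(fun s z => u s (z + (fun r => φ r • w) s) -
      deriv (fun r => φ r • w) s) t y‖) (𝓝[<] a) atTop := by
    intro y
    have hw' : 0 < ‖w‖ := norm_pos_iff.2 hw
    have hG : Tendsto (fun t => ‖w‖ * deriv φ t - C) (𝓝[<] a) atTop :=
      tendsto_atTop_add_const_right _ (-C) (Tendsto.const_mul_atTop hw' tendsto_deriv_frame)
    refine tendsto_atTop_mono' (𝓝[<] a) ?_ hG
    filter_upwards [Ioo_mem_nhdsLT ha] with t ht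
    have hdt := hdξ t ht.2
    simp only [hdt]
    have h1 := norm_sub_norm_le (deriv φ t • w) (u t (y + φ t • w))
    rw [norm_sub_rev] at h1
    have h2 : ‖deriv φ t • w‖ = |deriv φ t| * ‖w‖ := by rw [norm_smul, Real.norm_eq_abs]
    have h3 : ‖u t (y + φ t • w)‖ ≤ C := hC t ⟨ht.1.le, ht.2.le⟩ _
    have h4 : deriv φ t ≤ |deriv φ t| := le_abs_self _
    nlinarith
  refine ⟨fun t y => u t (y + (fun r => φ r • w) t) - deriv (fun r => φ r • w) t,
    fun t y => p t (y + (fun r => φ r • w) t) + ⟪deriv (deriv (fun r => φ r • w)) t, y⟫ -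
      (fun _ : ℝ => (0 : ℝ)) t, hb, ?_,
    fun t ht => (hper t ht.1).galileanBoost_velocity (fun r => φ r • w), hblow, ?_⟩
  · -- datum: `φ_a(0) = 0`, `φ_a′(0) = 0`
    funext y
    have hd0 : deriv (fun s => φ s • w) 0 = 0 := by
      rw [hdξ 0 ha, show deriv φ 0 = 0 from deriv_frame_zero ha.ne', zero_smul]
    simp only [hd0, sub_zero]
    rw [show φ 0 = 0 from frame_zero a, zero_smul, add_zero, h0]
  · rintro ⟨u', p', hu', -, -, hagree⟩
    refine hu'.not_tendsto_norm_atTop ha 0 ((hblow 0).congr' ?_)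
    filter_upwards [Ioo_mem_nhdsLT ha] with t ht
    rw [(hagree t ⟨ht.1.le, ht.2⟩).1]

/-- **Corollary in Fefferman's vocabulary (`ι = Fin 3`)**: if the printed periodic problem (B)
is solvable for `(ν, u₀)` — a pair `(u, p)` smooth on `ℝ³ × [0,∞)` solving (1)–(3) with `f ≡ 0`,
datum `u₀`, `u(·,t)` periodic — then for every `a > 0` there is ALSO a smooth periodic solution
from `u₀` on `[0, a)` that cannot be smoothly continued to `ℝ³ × [0,∞)`. The ∃-form of
"breakdown" is thus implied by solvability in the printed class and says nothing toward (D).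
[cite: Tao2013Localisation, §1 (after Prop. 1.7) and §3 eq. (galilean)] -/
theorem exists_nonContinuable_of_solvable_periodic {ν : ℝ}
    {u₀ : EuclideanSpace ℝ (Fin 3) → EuclideanSpace ℝ (Fin 3)}
    (h : ∃ (u : ℝ → EuclideanSpace ℝ (Fin 3) → EuclideanSpace ℝ (Fin 3))
      (p : ℝ → EuclideanSpace ℝ (Fin 3) → ℝ),
      IsSmoothOnHalfSpace u ∧ IsSmoothOnHalfSpace p ∧ IsNavierStokesSolution ν 0 u₀ u p ∧
        ∀ t, 0 ≤ t → IsLatticePeriodic (u t))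
    {a : ℝ} (ha : 0 < a) :
    ∃ (U : ℝ → EuclideanSpace ℝ (Fin 3) → EuclideanSpace ℝ (Fin 3))
      (P : ℝ → EuclideanSpace ℝ (Fin 3) → ℝ),
      IsClassicalNSSolutionOn (Ico 0 a) ν 0 U P ∧ U 0 = u₀ ∧
        (∀ t ∈ Ico 0 a, IsLatticePeriodic (U t)) ∧
        ¬ ∃ (u' : ℝ → EuclideanSpace ℝ (Fin 3) → EuclideanSpace ℝ (Fin 3))
            (p' : ℝ → EuclideanSpace ℝ (Fin 3) → ℝ),
            IsSmoothOnHalfSpace u' ∧ IsSmoothOnHalfSpace p' ∧ IsNavierStokesSolution ν 0 u₀ u' p' ∧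
              ∀ t ∈ Ico 0 a, u' t = U t ∧ p' t = P t := by
  obtain ⟨u, p, hu, hp, hns, hper⟩ := h
  have hw : (EuclideanSpace.single (0 : Fin 3) (1 : ℝ) : EuclideanSpace ℝ (Fin 3)) ≠ 0 := by
    intro h0
    have := congrArg (fun v : EuclideanSpace ℝ (Fin 3) => v 0) h0
    simp at this
  obtain ⟨U, P, hU, hU0, hUper, -, hno⟩ :=
    exists_nonContinuable_of_globalPeriodicSolution hns hu hp hper ha hw
  exact ⟨U, P, hU, hU0, hUper, hno⟩

end Main

end Literature.Analysis.FluidPDE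

end
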